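import Mathlib.Analysis.Polynomial.MahlerMeasure
import Mathlib.Algebra.MvPolynomial.Equiv
import Mathlib.Algebra.MvPolynomial.Degrees
import Mathlib.MeasureTheory.Constructions.Pi
import Mathlib.MeasureTheory.Integral.Prod
import Mathlib.Topology.Algebra.MvPolynomial
import Mathlib.Data.Nat.Choose.Vandermonde
import HarnessLib

/-!
# The Mahler measure of a complex polynomial in several variables (Bombieri–Gubler §1.6)

Topic `Literature/NumberTheory/DiophantineGeometry`. For `f ∈ ℂ[x₁, …, xₙ]` the (logarithmic)
**Mahler measure** is

  `log M(f) = ∫_{𝕋ⁿ} log |f(e^{iθ₁}, …, e^{iθₙ})| dμ₁ ⋯ dμₙ`, `dμ = dθ / 2π`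

(Bombieri–Gubler, *Heights in Diophantine Geometry*, §1.6, 1.6.4). This file sets it up for
`MvPolynomial (Fin n) ℂ` (`logMahler`) on the torus `Fin n → ℝ` of angles with the product of the
normalised angle measures (`torusMeasure`), and proves, entirely from Mathlib's one-variable theory
(`Polynomial.logMahlerMeasure`, a circle average) by induction on `n` (Fubini, splitting off the
variable `x₀` with `MvPolynomial.finSuccEquiv`):

* `torusMeasure_zeroSet_eq_zero` — the zero set of a non-zero polynomial on `𝕋ⁿ` is null;
* `integrable_log_norm_eval` — `log |f(e^{iθ})|` is integrable on `𝕋ⁿ`;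
* `logMahler_mul`, `logMahler_prod` — multiplicativity `M(fg) = M(f) M(g)` (1.6.4);
* `logMahler_succ` — `log M(f) = ∫_{𝕋ⁿ} log M(f(·, e^{iθ'})) dθ'` (the inductive formula used in the
  proof of Lemma 1.6.10);
* `logMahler_le_log_sum_norm_coeff` — `M(f) ≤ ℓ₁(f)` (Lemma 1.6.7/1.6.10, left);
* `log_norm_coeff_le_logMahler_add` — **Lemma 1.6.10** (right): `|a_𝐣| ≤ ∏ₖ C(dₖ, jₖ) · M(f)`,
  `dₖ` the partial degrees.

Gelfond's lemma (Lemma 1.6.11) is deduced in `GelfondLemma.lean`. Everything is proved; no named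
facts.

## References

* [BombieriGubler2006] E. Bombieri, W. Gubler, *Heights in Diophantine Geometry*, CUP 2006, §1.6:
  1.6.4 (Mahler measure, multiplicativity), Prop. 1.6.5, Lemma 1.6.7, Lemma 1.6.10 (pp. 22–27).
-/

noncomputable section

open MeasureTheory MvPolynomial Real Set Filter

open scoped ENNReal

namespace Literature.NumberTheory.DiophantineGeometry

/-! ### The normalised angle measure `dθ/2π` and the torus of angles -/

/-- The probability measure `dθ/2π` on the angles `(0, 2π]`, as a measure on `ℝ`.
[cite: BombieriGubler2006, §1.6, 1.6.4] -/
def angleMeasure : Measure ℝ :=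
  (ENNReal.ofReal (2 * π)⁻¹) • volume.restrict (Ioc 0 (2 * π))

/-- `dθ/2π` is a probability measure (kept as a theorem, instantiated locally with `haveI`).
[folklore] -/
theorem isProbabilityMeasure_angleMeasure : IsProbabilityMeasure angleMeasure := by
  constructor
  rw [angleMeasure, Measure.smul_apply, Measure.restrict_apply MeasurableSet.univ, univ_inter,
    Real.volume_Ioc, sub_zero, smul_eq_mul, ← ENNReal.ofReal_mul (by positivity),
    inv_mul_cancel₀ (by positivity), ENNReal.ofReal_one]

/-- Integration against `dθ/2π` through `circleMap 0 1` is Mathlib's circle average.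
[folklore] -/
theorem integral_angleMeasure_circleMap (f : ℂ → ℝ) :
    ∫ θ, f (circleMap 0 1 θ) ∂angleMeasure = circleAverage f 0 1 := by
  rw [angleMeasure, integral_smul_measure, circleAverage_def,
    intervalIntegral.integral_of_le (by positivity), ENNReal.toReal_ofReal (by positivity),
    smul_eq_mul]

/-- A set of angles whose image under `circleMap 0 1` is finite is `dθ/2π`-null. [folklore] -/
theorem angleMeasure_eq_zero_of_finite_image {B : Set ℝ} {Y : Set ℂ} (hY : Y.Finite)
    (hB : B ⊆ circleMap 0 1 ⁻¹' Y) : angleMeasure B = 0 := by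
  have hfin : (B ∩ Ioc 0 (2 * π)).Finite := by
    refine Set.Finite.of_finite_image (f := circleMap 0 1) (hY.subset ?_) ?_
    · rintro _ ⟨θ, hθ, rfl⟩
      exact hB hθ.1
    · have h := injOn_circleMap_of_abs_sub_le (a := 0) (b := 2 * π) (c := 0) one_ne_zero
        (by rw [zero_sub, abs_neg, abs_of_nonneg (by positivity)])
      rw [Set.uIoc_of_le (by positivity)] at h
      exact h.mono Set.inter_subset_right
  rw [angleMeasure, Measure.smul_apply, smul_eq_mul, Measure.restrict_apply' measurableSet_Ioc,
    hfin.measure_zero, mul_zero]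

variable {n : ℕ}

/-- The product measure `dθ₁/2π ⋯ dθₙ/2π` on the torus of angles `Fin n → ℝ`.
[cite: BombieriGubler2006, §1.6, 1.6.4] -/
def torusMeasure (n : ℕ) : Measure (Fin n → ℝ) :=
  Measure.pi fun _ => angleMeasure

/-- The torus measure is a probability measure. [folklore] -/
theorem isProbabilityMeasure_torusMeasure (n : ℕ) : IsProbabilityMeasure (torusMeasure n) := by
  haveI := isProbabilityMeasure_angleMeasure
  unfold torusMeasure
  infer_instance

/-- The point `(e^{iθ₁}, …, e^{iθₙ})` of the unit torus with angles `θ`. [folklore] -/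
def torusPt (θ : Fin n → ℝ) : Fin n → ℂ := fun v => circleMap 0 1 (θ v)

/-- `θ ↦ e^{iθ}` is continuous. [folklore] -/
theorem continuous_torusPt : Continuous (torusPt : (Fin n → ℝ) → Fin n → ℂ) :=
  continuous_pi fun v => (continuous_circleMap 0 1).comp (continuous_apply v)

/-- The coordinates of a torus point have modulus `1`. [folklore] -/
@[simp] theorem norm_torusPt (θ : Fin n → ℝ) (v : Fin n) : ‖torusPt θ v‖ = 1 := by
  simp [torusPt]

/-- Splitting off the first angle: `torusPt (a :: θ') = e^{ia} :: torusPt θ'`. [folklore] -/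
theorem torusPt_cons (a : ℝ) (θ' : Fin n → ℝ) :
    torusPt (Fin.cons a θ' : Fin (n + 1) → ℝ) = Fin.cons (circleMap 0 1 a) (torusPt θ') := by
  funext v
  refine Fin.cases ?_ (fun j => ?_) v <;> simp [torusPt]

/-- `θ ↦ f(e^{iθ})` is continuous. [folklore] -/
theorem continuous_eval_torusPt (p : MvPolynomial (Fin n) ℂ) :
    Continuous fun θ : Fin n → ℝ => eval (torusPt θ) p :=
  (MvPolynomial.continuous_eval p).comp continuous_torusPt

/-- `θ ↦ log |f(e^{iθ})|` is measurable. [folklore] -/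
theorem measurable_log_norm_eval (p : MvPolynomial (Fin n) ℂ) :
    Measurable fun θ : Fin n → ℝ => log ‖eval (torusPt θ) p‖ :=
  measurable_log.comp (continuous_eval_torusPt p).norm.measurable

/-! ### The Mahler measure -/

/-- The logarithmic **Mahler measure** `log M(f) = ∫_{𝕋ⁿ} log |f(e^{iθ})| dμ₁ ⋯ dμₙ` of
`f ∈ ℂ[x₀, …, x_{n−1}]` (with Lean's `log 0 = 0`, so that `log M(0) = 0`).
[cite: BombieriGubler2006, §1.6, 1.6.4] -/
def logMahler (p : MvPolynomial (Fin n) ℂ) : ℝ :=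
  ∫ θ, log ‖eval (torusPt θ) p‖ ∂torusMeasure n

/-- In no variables, `log M(c) = log |c|`. [folklore] -/
theorem logMahler_of_zero (p : MvPolynomial (Fin 0) ℂ) : logMahler p = log ‖coeff 0 p‖ := by
  have hp : p = C (coeff 0 p) := p.eq_C_of_isEmpty
  unfold logMahler torusMeasure
  rw [Measure.pi_of_empty (fun _ : Fin 0 => angleMeasure) (fun v => Fin.elim0 v)]
  rw [integral_dirac]
  conv_lhs => rw [hp, eval_C]

/-! ### Splitting off the variable `x₀`: the one-variable slices -/

/-- The one-variable slice `f(t, e^{iθ'}) ∈ ℂ[t]` of `f ∈ ℂ[x₀, …, xₙ]` at the angles `θ'` of the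
remaining variables. [folklore] -/
def slice (p : MvPolynomial (Fin (n + 1)) ℂ) (θ' : Fin n → ℝ) : Polynomial ℂ :=
  (finSuccEquiv ℂ n p).map (eval (torusPt θ'))

/-- `f(e^{ia}, e^{iθ'}) = f(·, e^{iθ'})(e^{ia})`. [folklore] -/
theorem eval_torusPt_cons (p : MvPolynomial (Fin (n + 1)) ℂ) (a : ℝ) (θ' : Fin n → ℝ) :
    eval (torusPt (Fin.cons a θ' : Fin (n + 1) → ℝ)) p = (slice p θ').eval (circleMap 0 1 a) := by
  rw [torusPt_cons, eval_eq_eval_mv_eval', slice]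

/-- The polynomial `f(y, ·) ∈ ℂ[x₁, …, xₙ]` obtained by substituting the constant `y` for `x₀`.
[folklore] -/
def specialize (p : MvPolynomial (Fin (n + 1)) ℂ) (y : ℂ) : MvPolynomial (Fin n) ℂ :=
  (finSuccEquiv ℂ n p).eval (C y)

/-- `f(y, ·)(e^{iθ'}) = f(·, e^{iθ'})(y)`. [folklore] -/
theorem eval_specialize (p : MvPolynomial (Fin (n + 1)) ℂ) (y : ℂ) (θ' : Fin n → ℝ) :
    eval (torusPt θ') (specialize p y) = (slice p θ').eval y := by
  rw [specialize, slice, Polynomial.eval_map, Polynomial.eval, Polynomial.hom_eval₂,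
    RingHom.comp_id, eval_C]

/-- Only finitely many substitutions `x₀ = y` kill a non-zero polynomial. [folklore] -/
theorem finite_setOf_specialize_eq_zero {p : MvPolynomial (Fin (n + 1)) ℂ} (hp : p ≠ 0) :
    {y : ℂ | specialize p y = 0}.Finite := by
  have hP : finSuccEquiv ℂ n p ≠ 0 := (EmbeddingLike.map_ne_zero_iff).mpr hp
  have hfin := Polynomial.finite_setOf_isRoot hP
  have : {y : ℂ | specialize p y = 0} = C ⁻¹' {x | (finSuccEquiv ℂ n p).IsRoot x} := by
    ext y
    simp [specialize, Polynomial.IsRoot]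
  rw [this]
  exact hfin.preimage (C_injective _ _).injOn

/-! ### Transfer to the product `angle × torus` -/

/-- The splitting `(a, θ') ↦ a :: θ'` is measure preserving from `dθ/2π ⊗ (torus measure)` to
the torus measure in one more variable. [folklore] -/
theorem measurePreserving_cons :
    MeasurePreserving (MeasurableEquiv.piFinSuccAbove (fun _ : Fin (n + 1) => ℝ) 0).symm
      (angleMeasure.prod (torusMeasure n)) (torusMeasure (n + 1)) := by
  haveI := isProbabilityMeasure_angleMeasure
  exact (measurePreserving_piFinSuccAbove (fun _ : Fin (n + 1) => angleMeasure) 0).symm _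

/-- The inverse splitting map is `(a, θ') ↦ a :: θ'`. [folklore] -/
theorem piFinSuccAbove_symm_apply' (x : ℝ × (Fin n → ℝ)) :
    (MeasurableEquiv.piFinSuccAbove (fun _ : Fin (n + 1) => ℝ) 0).symm x = Fin.cons x.1 x.2 := by
  rw [MeasurableEquiv.piFinSuccAbove_symm_apply, Fin.insertNthEquiv, Equiv.coe_fn_mk,
    Fin.insertNth_zero']

/-- Integrals over the torus in `n + 1` angles as iterated-able integrals over `angle × torus`.
[folklore] -/
theorem integral_torusMeasure_succ (F : (Fin (n + 1) → ℝ) → ℝ) :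
    ∫ θ, F θ ∂torusMeasure (n + 1) =
      ∫ x : ℝ × (Fin n → ℝ), F (Fin.cons x.1 x.2) ∂angleMeasure.prod (torusMeasure n) := by
  rw [← (measurePreserving_cons (n := n)).integral_comp']
  simp_rw [piFinSuccAbove_symm_apply']

/-- Integrability over the torus in `n + 1` angles versus over `angle × torus`. [folklore] -/
theorem integrable_torusMeasure_succ_iff (F : (Fin (n + 1) → ℝ) → ℝ) :
    Integrable F (torusMeasure (n + 1)) ↔
      Integrable (fun x : ℝ × (Fin n → ℝ) => F (Fin.cons x.1 x.2))
        (angleMeasure.prod (torusMeasure n)) := by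
  rw [← (measurePreserving_cons (n := n)).integrable_comp_emb
    (MeasurableEquiv.measurableEmbedding _)]
  simp_rw [Function.comp_def, piFinSuccAbove_symm_apply']

/-- Measures of sets of the torus in `n + 1` angles versus `angle × torus`. [folklore] -/
theorem torusMeasure_succ_apply (S : Set (Fin (n + 1) → ℝ)) :
    torusMeasure (n + 1) S =
      angleMeasure.prod (torusMeasure n) {x : ℝ × (Fin n → ℝ) | (Fin.cons x.1 x.2 : Fin (n + 1) → ℝ) ∈ S} := by
  rw [← (measurePreserving_cons (n := n)).measure_preimage_equiv S]
  congr 1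
  ext x
  simp only [mem_preimage, mem_setOf_eq, piFinSuccAbove_symm_apply']

/-! ### The zero set of a non-zero polynomial on the torus is null -/

/-- The zero set `{θ : f(e^{iθ}) = 0}` is measurable (closed). [folklore] -/
theorem measurableSet_zeroSet (p : MvPolynomial (Fin n) ℂ) :
    MeasurableSet {θ : Fin n → ℝ | eval (torusPt θ) p = 0} :=
  (isClosed_singleton.preimage (continuous_eval_torusPt p)).measurableSet

/-- **The zero set of a non-zero polynomial on `𝕋ⁿ` is null** (induction on `n`: by Fubini it
suffices that almost every slice is null; the slice at `x₀ = e^{ia}` is the zero set of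
`f(e^{ia}, ·)`, which is a non-zero polynomial for all but finitely many `a`). [folklore] -/
theorem torusMeasure_zeroSet_eq_zero :
    ∀ {n : ℕ} (p : MvPolynomial (Fin n) ℂ), p ≠ 0 →
      torusMeasure n {θ : Fin n → ℝ | eval (torusPt θ) p = 0} = 0 := by
  intro n
  induction n with
  | zero =>
    intro p hp
    have h : {θ : Fin 0 → ℝ | eval (torusPt θ) p = 0} = ∅ := by
      ext θ
      simp only [mem_setOf_eq, mem_empty_iff_false, iff_false]
      rw [p.eq_C_of_isEmpty, eval_C]
      intro h0
      apply hp
      rw [p.eq_C_of_isEmpty, h0, C_0]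
    rw [h, measure_empty]
  | succ n ih =>
    intro p hp
    haveI := isProbabilityMeasure_angleMeasure
    haveI := isProbabilityMeasure_torusMeasure n
    rw [torusMeasure_succ_apply]
    have hmeas : MeasurableSet
        {x : ℝ × (Fin n → ℝ) | (Fin.cons x.1 x.2 : Fin (n + 1) → ℝ) ∈
          {θ : Fin (n + 1) → ℝ | eval (torusPt θ) p = 0}} := by
      have h := (measurableSet_zeroSet p).preimage
        (MeasurableEquiv.piFinSuccAbove (fun _ : Fin (n + 1) => ℝ) 0).symm.measurable
      convert h using 1
      ext x
      simp only [mem_setOf_eq, mem_preimage, piFinSuccAbove_symm_apply']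
    rw [Measure.measure_prod_null hmeas]
    -- off the finitely many bad angles `a`, the slice is the zero set of `f(e^{ia}, ·) ≠ 0`
    have hbad : angleMeasure {a : ℝ | specialize p (circleMap 0 1 a) = 0} = 0 :=
      angleMeasure_eq_zero_of_finite_image (finite_setOf_specialize_eq_zero hp) (fun a ha => ha)
    rw [Filter.EventuallyEq, ae_iff]
    refine measure_mono_null (fun a ha => ?_) hbad
    simp only [Pi.zero_apply, mem_setOf_eq] at ha ⊢
    by_contra hne
    apply ha
    have hset : (Prod.mk a ⁻¹' {x : ℝ × (Fin n → ℝ) |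
        eval (torusPt (Fin.cons x.1 x.2 : Fin (n + 1) → ℝ)) p = 0}) =
        {θ' : Fin n → ℝ | eval (torusPt θ') (specialize p (circleMap 0 1 a)) = 0} := by
      ext θ'
      simp only [mem_preimage, mem_setOf_eq, eval_torusPt_cons, eval_specialize]
    rw [hset]
    exact ih _ hne

/-- Almost every point of the torus is not a zero of a non-zero polynomial. [folklore] -/
theorem ae_eval_ne_zero {p : MvPolynomial (Fin n) ℂ} (hp : p ≠ 0) :
    ∀ᵐ θ ∂torusMeasure n, eval (torusPt θ) p ≠ 0 := by
  have h := torusMeasure_zeroSet_eq_zero p hp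
  rw [measure_eq_zero_iff_ae_notMem] at h
  filter_upwards [h] with θ hθ
  simpa using hθ


/-! ### Integrability of `log |f(e^{iθ})|` on the torus -/

/-- The splitting map `(a, θ') ↦ a :: θ'` is measurable. [folklore] -/
theorem measurable_cons :
    Measurable fun x : ℝ × (Fin n → ℝ) => (Fin.cons x.1 x.2 : Fin (n + 1) → ℝ) := by
  have h := (MeasurableEquiv.piFinSuccAbove (fun _ : Fin (n + 1) => ℝ) 0).symm.measurable
  rwa [show ((MeasurableEquiv.piFinSuccAbove (fun _ : Fin (n + 1) => ℝ) 0).symm :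
      ℝ × (Fin n → ℝ) → Fin (n + 1) → ℝ) = fun x => Fin.cons x.1 x.2 from
    funext piFinSuccAbove_symm_apply'] at h

/-- On the torus, `|f(e^{iθ})| ≤ ∑ |a_𝐣|`. [folklore] -/
theorem norm_eval_torusPt_le (p : MvPolynomial (Fin n) ℂ) (θ : Fin n → ℝ) :
    ‖eval (torusPt θ) p‖ ≤ ∑ e ∈ p.support, ‖coeff e p‖ := by
  rw [eval_eq']
  refine (norm_sum_le _ _).trans (Finset.sum_le_sum fun e _ => ?_)
  rw [norm_mul, norm_prod]
  simp [norm_pow]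

/-- The one-variable slices `a ↦ log |f(e^{ia}, e^{iθ'})|` are integrable for `dθ/2π` (Mathlib's
integrability of `log |q|` on the circle). [folklore] -/
theorem integrable_log_norm_slice (p : MvPolynomial (Fin (n + 1)) ℂ) (θ' : Fin n → ℝ) :
    Integrable (fun a : ℝ => log ‖(slice p θ').eval (circleMap 0 1 a)‖) angleMeasure := by
  have h := (slice p θ').intervalIntegrable_mahlerMeasure
  rw [intervalIntegrable_iff_integrableOn_Ioc_of_le (by positivity)] at h
  rw [angleMeasure]
  exact h.integrable.smul_measure ENNReal.ofReal_ne_top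

/-- `∫ log |f(e^{ia}, e^{iθ'})| da/2π = log M(f(·, e^{iθ'}))`. [folklore] -/
theorem integral_log_norm_slice (p : MvPolynomial (Fin (n + 1)) ℂ) (θ' : Fin n → ℝ) :
    ∫ a, log ‖(slice p θ').eval (circleMap 0 1 a)‖ ∂angleMeasure =
      (slice p θ').logMahlerMeasure := by
  rw [Polynomial.logMahlerMeasure_def]
  exact integral_angleMeasure_circleMap (fun z => log ‖(slice p θ').eval z‖)

/-- `|x| = 2 max(x, 0) − x`. [folklore] -/
theorem abs_eq_two_mul_max_sub (x : ℝ) : |x| = 2 * max x 0 - x := by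
  rcases le_total 0 x with h | h
  · rw [abs_of_nonneg h, max_eq_left h]; ring
  · rw [abs_of_nonpos h, max_eq_right h]; ring

/-- The key slice estimate for integrability and Fubini: if the leading coefficient `c(x')` of `f`
in `x₀` does not vanish at `e^{iθ'}`, then
`∫ |log |f(e^{ia}, e^{iθ'})|| da/2π ≤ 2 log⁺ ℓ₁(f) − log |c(e^{iθ'})|`
(from `∫ = log M ≥ log |leading coefficient|` and `log |f| ≤ log⁺ ℓ₁(f)` on the torus).
[cite: BombieriGubler2006, §1.6, Prop. 1.6.5 and Lemma 1.6.7] -/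
theorem integral_abs_log_norm_slice_le (p : MvPolynomial (Fin (n + 1)) ℂ) (θ' : Fin n → ℝ)
    (hc : eval (torusPt θ') (finSuccEquiv ℂ n p).leadingCoeff ≠ 0) :
    ∫ a, ‖log ‖(slice p θ').eval (circleMap 0 1 a)‖‖ ∂angleMeasure ≤
      2 * posLog (∑ e ∈ p.support, ‖coeff e p‖) -
        log ‖eval (torusPt θ') (finSuccEquiv ℂ n p).leadingCoeff‖ := by
  haveI := isProbabilityMeasure_angleMeasure
  have hlead : (slice p θ').leadingCoeff = eval (torusPt θ') (finSuccEquiv ℂ n p).leadingCoeff :=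
    Polynomial.leadingCoeff_map_of_leadingCoeff_ne_zero _ hc
  have hq0 : slice p θ' ≠ 0 := by
    intro h
    apply hc
    rw [← hlead, h, Polynomial.leadingCoeff_zero]
  have hint := integrable_log_norm_slice p θ'
  -- `∫ |G| = 2 ∫ max(G, 0) - ∫ G`
  have e1 : ∫ a, ‖log ‖(slice p θ').eval (circleMap 0 1 a)‖‖ ∂angleMeasure =
      2 * ∫ a, max (log ‖(slice p θ').eval (circleMap 0 1 a)‖) 0 ∂angleMeasure -
        ∫ a, log ‖(slice p θ').eval (circleMap 0 1 a)‖ ∂angleMeasure := by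
    rw [← integral_const_mul, ← integral_sub (hint.pos_part.const_mul 2) hint]
    refine integral_congr_ae (ae_of_all _ fun a => ?_)
    simp only [Real.norm_eq_abs, abs_eq_two_mul_max_sub]
  -- `∫ max(G, 0) ≤ log⁺ L`
  have e2 : ∫ a, max (log ‖(slice p θ').eval (circleMap 0 1 a)‖) 0 ∂angleMeasure ≤
      posLog (∑ e ∈ p.support, ‖coeff e p‖) := by
    have h := integral_mono hint.pos_part (integrable_const (posLog (∑ e ∈ p.support, ‖coeff e p‖)))
      fun a => by
        have hle : ‖(slice p θ').eval (circleMap 0 1 a)‖ ≤ ∑ e ∈ p.support, ‖coeff e p‖ := by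
          rw [← eval_torusPt_cons]
          exact norm_eval_torusPt_le p _
        change max (log ‖(slice p θ').eval (circleMap 0 1 a)‖) 0 ≤ posLog (∑ e ∈ p.support, ‖coeff e p‖)
        rw [max_comm]
        exact monotoneOn_posLog (Set.mem_Ici.mpr (norm_nonneg _))
          (Set.mem_Ici.mpr ((norm_nonneg _).trans hle)) hle
    simpa using h
  -- `∫ G = log M(q) ≥ log |leading coefficient|`
  have e3 : log ‖eval (torusPt θ') (finSuccEquiv ℂ n p).leadingCoeff‖ ≤
      ∫ a, log ‖(slice p θ').eval (circleMap 0 1 a)‖ ∂angleMeasure := by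
    have hM : (slice p θ').mahlerMeasure = exp (slice p θ').logMahlerMeasure := by
      rw [Polynomial.mahlerMeasure, if_pos hq0]
    rw [integral_log_norm_slice, ← hlead, Real.log_le_iff_le_exp (norm_pos_iff.mpr _), ← hM]
    · exact (slice p θ').leadingCoeff_le_mahlerMeasure
    · rwa [hlead]
  rw [e1]
  linarith

/-- **`log |f(e^{iθ})|` is integrable on `𝕋ⁿ`** for every `f` (induction on `n` with Fubini:
the slices are integrable by the one-variable theory, and their absolute integrals are bounded by
`2 log⁺ ℓ₁(f) − log |c(e^{iθ'})|`, `c` the leading coefficient in `x₀`, which is integrable in `θ'`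
by induction). [cite: BombieriGubler2006, §1.6, 1.6.4] -/
theorem integrable_log_norm_eval :
    ∀ {n : ℕ} (p : MvPolynomial (Fin n) ℂ),
      Integrable (fun θ : Fin n → ℝ => log ‖eval (torusPt θ) p‖) (torusMeasure n) := by
  intro n
  induction n with
  | zero =>
    intro p
    haveI := isProbabilityMeasure_torusMeasure 0
    have h : (fun θ : Fin 0 → ℝ => log ‖eval (torusPt θ) p‖) = fun _ => log ‖coeff 0 p‖ := by
      funext θ
      conv_lhs => rw [p.eq_C_of_isEmpty, eval_C]
    rw [h]
    exact integrable_const _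
  | succ n ih =>
    intro p
    haveI := isProbabilityMeasure_angleMeasure
    haveI := isProbabilityMeasure_torusMeasure n
    by_cases hp : p = 0
    · haveI := isProbabilityMeasure_torusMeasure (n + 1)
      simp only [hp, map_zero, norm_zero, log_zero]
      exact integrable_const _
    rw [integrable_torusMeasure_succ_iff]
    have hGm : Measurable fun x : ℝ × (Fin n → ℝ) =>
        log ‖eval (torusPt (Fin.cons x.1 x.2 : Fin (n + 1) → ℝ)) p‖ :=
      (measurable_log_norm_eval p).comp measurable_cons
    rw [integrable_prod_iff' hGm.aestronglyMeasurable]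
    constructor
    · refine ae_of_all _ fun θ' => ?_
      simp_rw [eval_torusPt_cons]
      exact integrable_log_norm_slice p θ'
    · -- the absolute slice integrals are dominated by an integrable function of `θ'`
      set c : MvPolynomial (Fin n) ℂ := (finSuccEquiv ℂ n p).leadingCoeff with hc
      have hc0 : c ≠ 0 := by
        rw [hc, Ne, Polynomial.leadingCoeff_eq_zero]
        exact (EmbeddingLike.map_ne_zero_iff).mpr hp
      set L := ∑ e ∈ p.support, ‖coeff e p‖ with hL
      refine Integrable.mono' (g := fun θ' => 2 * posLog L + ‖log ‖eval (torusPt θ') c‖‖)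
        ((integrable_const _).add (ih c).norm) ?_ ?_
      · have h := (hGm.comp measurable_swap).norm.aestronglyMeasurable.integral_prod_right'
          (μ := torusMeasure n) (ν := angleMeasure)
        simpa using h
      · filter_upwards [ae_eval_ne_zero hc0] with θ' hθ'
        rw [Real.norm_of_nonneg (integral_nonneg fun a => norm_nonneg _)]
        simp_rw [eval_torusPt_cons]
        have h := integral_abs_log_norm_slice_le p θ' hθ'
        have h' : -log ‖eval (torusPt θ') c‖ ≤ ‖log ‖eval (torusPt θ') c‖‖ := by
          rw [Real.norm_eq_abs]
          exact neg_le_abs _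
        linarith

/-! ### Multiplicativity -/

/-- **`M(fg) = M(f) M(g)`** for non-zero `f, g` (pointwise `log |fg| = log |f| + log |g|` off
the null zero sets). [cite: BombieriGubler2006, §1.6, 1.6.4] -/
theorem logMahler_mul {p q : MvPolynomial (Fin n) ℂ} (hp : p ≠ 0) (hq : q ≠ 0) :
    logMahler (p * q) = logMahler p + logMahler q := by
  unfold logMahler
  rw [← integral_add (integrable_log_norm_eval p) (integrable_log_norm_eval q)]
  refine integral_congr_ae ?_
  filter_upwards [ae_eval_ne_zero hp, ae_eval_ne_zero hq] with θ h1 h2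
  rw [map_mul, norm_mul, Real.log_mul (norm_ne_zero_iff.mpr h1) (norm_ne_zero_iff.mpr h2)]

/-- `log M(c) = log |c|` for a constant. [folklore] -/
theorem logMahler_C (c : ℂ) : logMahler (C c : MvPolynomial (Fin n) ℂ) = log ‖c‖ := by
  haveI := isProbabilityMeasure_torusMeasure n
  simp [logMahler]

/-- `log M(1) = 0`. [folklore] -/
theorem logMahler_one : logMahler (1 : MvPolynomial (Fin n) ℂ) = 0 := by
  rw [← C_1, logMahler_C, norm_one, log_one]

/-- **`M(∏ fⱼ) = ∏ M(fⱼ)`** for non-zero `fⱼ`. [cite: BombieriGubler2006, §1.6, 1.6.4] -/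
theorem logMahler_prod {ι : Type*} (s : Finset ι) (f : ι → MvPolynomial (Fin n) ℂ)
    (hf : ∀ j ∈ s, f j ≠ 0) : logMahler (∏ j ∈ s, f j) = ∑ j ∈ s, logMahler (f j) := by
  classical
  induction s using Finset.induction_on with
  | empty => simp [logMahler_one]
  | insert a s ha ih =>
    rw [Finset.prod_insert ha, Finset.sum_insert ha,
      logMahler_mul (hf a (Finset.mem_insert_self a s))
        (Finset.prod_ne_zero_iff.mpr fun j hj => hf j (Finset.mem_insert_of_mem hj)),
      ih fun j hj => hf j (Finset.mem_insert_of_mem hj)]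

/-! ### The inductive formula: integrate the one-variable Mahler measures of the slices -/

/-- **`log M(f) = ∫_{𝕋ⁿ} log M(f(·, e^{iθ'})) dθ'`** (Fubini), the formula B–G use in the proof of
Lemma 1.6.10. [cite: BombieriGubler2006, §1.6, proof of Lemma 1.6.10] -/
theorem logMahler_succ (p : MvPolynomial (Fin (n + 1)) ℂ) :
    logMahler p = ∫ θ', (slice p θ').logMahlerMeasure ∂torusMeasure n := by
  haveI := isProbabilityMeasure_angleMeasure
  haveI := isProbabilityMeasure_torusMeasure n
  have hint := (integrable_torusMeasure_succ_iff _).mp (integrable_log_norm_eval p)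
  unfold logMahler
  rw [integral_torusMeasure_succ, integral_prod_symm _ hint]
  refine integral_congr_ae (ae_of_all _ fun θ' => ?_)
  simp_rw [eval_torusPt_cons]
  exact integral_log_norm_slice p θ'

/-- `θ' ↦ log M(f(·, e^{iθ'}))` is integrable on `𝕋ⁿ`. [folklore] -/
theorem integrable_logMahlerMeasure_slice (p : MvPolynomial (Fin (n + 1)) ℂ) :
    Integrable (fun θ' => (slice p θ').logMahlerMeasure) (torusMeasure n) := by
  haveI := isProbabilityMeasure_angleMeasure
  haveI := isProbabilityMeasure_torusMeasure n
  have hint := (integrable_torusMeasure_succ_iff _).mp (integrable_log_norm_eval p)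
  have h := hint.integral_prod_right
  refine h.congr (ae_of_all _ fun θ' => ?_)
  simp_rw [eval_torusPt_cons]
  exact integral_log_norm_slice p θ'


/-! ### `M(f) ≤ ℓ₁(f)` -/

/-- A non-zero polynomial has a coefficient, so `ℓ₁(f) > 0`. [folklore] -/
theorem sum_norm_coeff_pos {p : MvPolynomial (Fin n) ℂ} (hp : p ≠ 0) :
    0 < ∑ e ∈ p.support, ‖coeff e p‖ := by
  obtain ⟨e, he⟩ := exists_coeff_ne_zero hp
  exact Finset.sum_pos' (fun _ _ => norm_nonneg _) ⟨e, mem_support_iff.mpr he, norm_pos_iff.mpr he⟩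

/-- **`log M(f) ≤ log ℓ₁(f)`** (the trivial direction of Lemma 1.6.7 / 1.6.10: `|f| ≤ ℓ₁(f)` on
the torus). [cite: BombieriGubler2006, §1.6, Lemma 1.6.7] -/
theorem logMahler_le_log_sum_norm_coeff {p : MvPolynomial (Fin n) ℂ} (hp : p ≠ 0) :
    logMahler p ≤ log (∑ e ∈ p.support, ‖coeff e p‖) := by
  haveI := isProbabilityMeasure_torusMeasure n
  have hL := sum_norm_coeff_pos hp
  unfold logMahler
  calc ∫ θ, log ‖eval (torusPt θ) p‖ ∂torusMeasure n
      ≤ ∫ _θ, log (∑ e ∈ p.support, ‖coeff e p‖) ∂torusMeasure n := by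
        refine integral_mono_ae (integrable_log_norm_eval p) (integrable_const _) ?_
        filter_upwards [ae_eval_ne_zero hp] with θ hθ
        exact Real.log_le_log (norm_pos_iff.mpr hθ) (norm_eval_torusPt_le p θ)
    _ = log (∑ e ∈ p.support, ‖coeff e p‖) := by simp

/-! ### Lemma 1.6.10: coefficients are bounded by binomials times the Mahler measure -/

/-- **Bombieri–Gubler Lemma 1.6.10** (right-hand inequality, logarithmic form): for every
coefficient `a_𝐣 ≠ 0` of `f ∈ ℂ[x₀, …, x_{n−1}]` with partial degrees `d₀, …, d_{n−1}`,
`log |a_𝐣| ≤ log M(f) + ∑ₖ log C(dₖ, jₖ)`. Proof by induction on `n`: writing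
`f = ∑ᵢ fᵢ(x₁, …) x₀^i`, Fubini (`logMahler_succ`) and the one-variable bound
`|coefficient| ≤ C(d, i) M` (Mathlib's `Polynomial.norm_coeff_le_choose_mul_mahlerMeasure`) at
almost every slice give `log M(f_{j₀}) ≤ log M(f) + log C(d₀, j₀)`; induction on `f_{j₀}` finishes.
[cite: BombieriGubler2006, §1.6, Lemma 1.6.10 (p. 27)] -/
theorem log_norm_coeff_le_logMahler_add :
    ∀ {n : ℕ} (p : MvPolynomial (Fin n) ℂ) (e : Fin n →₀ ℕ), coeff e p ≠ 0 →
      log ‖coeff e p‖ ≤ logMahler p + ∑ v, log ((degreeOf v p).choose (e v)) := by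
  intro n
  induction n with
  | zero =>
    intro p e he
    have he0 : e = 0 := Subsingleton.elim e 0
    subst he0
    rw [logMahler_of_zero]
    simp
  | succ n ih =>
    intro p e he
    haveI := isProbabilityMeasure_angleMeasure
    haveI := isProbabilityMeasure_torusMeasure n
    -- the coefficient polynomial `c = f_{e 0}` of `x₀^{e 0}` and the remaining exponent `e'`
    set c : MvPolynomial (Fin n) ℂ := (finSuccEquiv ℂ n p).coeff (e 0) with hc
    have hce : coeff (Finsupp.tail e) c = coeff e p := by
      rw [hc, finSuccEquiv_coeff_coeff, Finsupp.cons_tail]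
    have hc' : coeff (Finsupp.tail e) c ≠ 0 := by rwa [hce]
    have hc0 : c ≠ 0 := fun h => hc' (by rw [h, coeff_zero])
    -- step A: `log M(c) ≤ log M(f) + log C(d₀, e 0)`
    have hA : logMahler c ≤ logMahler p + log ((degreeOf 0 p).choose (e 0)) := by
      rw [logMahler_succ]
      unfold logMahler
      calc ∫ θ', log ‖eval (torusPt θ') c‖ ∂torusMeasure n
          ≤ ∫ θ', ((slice p θ').logMahlerMeasure + log ((degreeOf 0 p).choose (e 0)))
              ∂torusMeasure n := by
            refine integral_mono_ae (integrable_log_norm_eval c)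
              ((integrable_logMahlerMeasure_slice p).add (integrable_const _)) ?_
            filter_upwards [ae_eval_ne_zero hc0] with θ' hθ'
            -- at a good slice: `|c(e^{iθ'})| = |coeff (e 0) of the slice| ≤ C(deg, e 0) M(slice)`
            have hcoeff : (slice p θ').coeff (e 0) = eval (torusPt θ') c := by
              rw [slice, Polynomial.coeff_map, hc]
            have hq0 : slice p θ' ≠ 0 := fun h => hθ' (by rw [← hcoeff, h, Polynomial.coeff_zero])
            have hM : (slice p θ').mahlerMeasure = exp (slice p θ').logMahlerMeasure := by
              rw [Polynomial.mahlerMeasure, if_pos hq0]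
            have hle : e 0 ≤ (slice p θ').natDegree :=
              Polynomial.le_natDegree_of_ne_zero (by rwa [hcoeff])
            have hdeg : (slice p θ').natDegree ≤ degreeOf 0 p := by
              rw [← natDegree_finSuccEquiv]
              exact Polynomial.natDegree_map_le
            have h1 := Polynomial.norm_coeff_le_choose_mul_mahlerMeasure (e 0) (slice p θ')
            rw [hcoeff, hM] at h1
            have hCpos : (0 : ℝ) < ((slice p θ').natDegree.choose (e 0) : ℕ) := by
              exact_mod_cast Nat.choose_pos hle
            have hC : (((slice p θ').natDegree.choose (e 0) : ℕ) : ℝ) ≤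
                ((degreeOf 0 p).choose (e 0) : ℕ) := by
              exact_mod_cast Nat.choose_le_choose (e 0) hdeg
            calc log ‖eval (torusPt θ') c‖
                ≤ log (((slice p θ').natDegree.choose (e 0) : ℕ) *
                    exp (slice p θ').logMahlerMeasure) :=
                  Real.log_le_log (norm_pos_iff.mpr hθ') h1
              _ = (slice p θ').logMahlerMeasure + log ((slice p θ').natDegree.choose (e 0) : ℕ) := by
                  rw [Real.log_mul hCpos.ne' (exp_pos _).ne', Real.log_exp, add_comm]
              _ ≤ (slice p θ').logMahlerMeasure + log ((degreeOf 0 p).choose (e 0) : ℕ) := by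
                  gcongr
        _ = (∫ θ', (slice p θ').logMahlerMeasure ∂torusMeasure n) +
              log ((degreeOf 0 p).choose (e 0)) := by
            rw [integral_add (integrable_logMahlerMeasure_slice p) (integrable_const _)]
            simp
    -- step B: the induction hypothesis for `c`, and the comparison of the binomials
    have hB := ih c (Finsupp.tail e) hc'
    have hC : ∑ v : Fin n, log (((degreeOf v c).choose (Finsupp.tail e v) : ℕ) : ℝ) ≤
        ∑ v : Fin n, log (((degreeOf v.succ p).choose (e v.succ) : ℕ) : ℝ) := by
      refine Finset.sum_le_sum fun v _ => ?_
      have hsupp : Finsupp.tail e ∈ c.support := mem_support_iff.mpr hc'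
      have hle : Finsupp.tail e v ≤ degreeOf v c := monomial_le_degreeOf v hsupp
      have hpos : (0 : ℝ) < ((degreeOf v c).choose (Finsupp.tail e v) : ℕ) := by
        exact_mod_cast Nat.choose_pos hle
      refine Real.log_le_log hpos ?_
      rw [Finsupp.tail_apply]
      exact_mod_cast Nat.choose_le_choose (e v.succ) (degreeOf_coeff_finSuccEquiv p v (e 0))
    rw [← hce, Fin.sum_univ_succ]
    linarith

end Literature.NumberTheory.DiophantineGeometry

end
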